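import Mathlib
import Literature.MathematicalPhysics.QuantumManyBody.PeriodicBoseGasUpperBoundProofs
import Literature.MathematicalPhysics.QuantumManyBody.HardCoreScatteringLength

/-!
# Complete BEC of periodic near-ground states on Gross–Pitaevskii⁺ boxes

Kernel K32 of the solo-blind programme (session s78).  The lower edge of the located wall, in the
tree's periodic vocabulary: the two literature results

* `Fournais2020_condensation` — [Fournais2020, Thm. 1.2], vendored in `PeriodicBoseGas.lean` and
  PROVED in the tree (`Fournais2020_condensation_holds`, `PeriodicBoseGasCondensationHolds.lean`,
  axioms `propext`/`Classical.choice`/`Quot.sound` only): on the torus of side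
  `L = C_L (ρa³)^{-δ} (ρa)^{-1/2}` every periodic state with `⟨Ψ,HΨ⟩ ≤ 4πaρN + C₀aρ(ρa³)^{1/2-ε}N`
  has `N - ⟨Ψ,n₀Ψ⟩ ≤ CρaL²(ρa³)^{1/2-ε}N` (statewise; the energy bound is a hypothesis), and
* `LSSY2005_upperBound_periodic_holds` — [LSSY2005, Thm. 2.2 (2.14)], the Dyson–LSSY upper bound
  `E₀^per(N,L) ≤ 4πρ₁a(1 + C·a/b)N`, `ρ₁ = (N-1)/L³`, `b = (4πρ₁/3)^{-1/3}` (proved in the tree),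

are joined (with `ε = 1/6`, i.e. relative energy precision `(ρa³)^{1/3} ≥ const·a/b`) into
`periodicNearGroundState_condensation_gpScale`: for an integrable repulsive potential of finite
range with `a > 0`, every `C_L > 0` and `δ > 0`, there are `C, c > 0` such that on the torus of side
`L = C_L(ρa³)^{-δ}(ρa)^{-1/2}` (`ρ = N/L³`, `ρa³ ≤ c`, `L > 2R₀`) EVERY periodic trial state within
`aρ(ρa³)^{1/3}N` of the ground-state energy satisfies `N ≤ ⟨Ψ,n₀Ψ⟩ + C ρaL² (ρa³)^{1/3} N`, and
`ρaL² = C_L²(ρa³)^{-2δ}` (`gpScale_rho_a_L_sq`), so the depletion is `≤ C C_L² (ρa³)^{1/3-2δ} N`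
(`…_rate`): complete condensation of near-ground states for `δ < 1/6`.

Form.  Both theorems take the named fact `Fournais2020_condensation` as their first hypothesis
`(hFou : Fournais2020_condensation)` — the tree discharges it by the single token
`Fournais2020_condensation_holds`; it is kept as a binder only so that this file's import cone is
`PeriodicBoseGas`/`…UpperBoundProofs`/`HardCoreScatteringLength` (the proof tower of Thm. 1.2 runs
through `Literature.Analysis.FluidPDE.NSFourierPlancherel`).  Nothing else is assumed.

Scope (what this is NOT).  The box is pinned to the density at the scale `(ρa³)^{-δ}` healing
lengths (`L = C_L a (ρa³)^{-1/2-δ}`, so `N = ρL³ = C_L³ (ρa³)^{-1/2-3δ}`: a FIXED particle number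
for each value of `ρa³`); the conjunct `BoseEinsteinCondensation` asks for `L = (N/ρ)^{1/3} → ∞`
at fixed `ρ` (Dirichlet conditions, hard cores allowed, `c(ρ)N ≤` the largest eigenvalue of `γ`).
Passing from `L_F` to `(N/ρ)^{1/3}` is exactly the located wall (an `L`-uniform bound on
`Σ_{2π/L ≤ |p| ≤ 2π/L_F} n_p`); nothing here bears on it.  Periodic b.c. and `v ∈ L¹` (no hard
core) are inherited from [Fournais2020, Assumption 1.1].

## References

* [Fournais2020] S. Fournais, *Length scales for BEC in the dilute Bose gas*, in: Partial
  Differential Equations, Spectral Theory, and Mathematical Physics, EMS Ser. Congr. Rep. 18 (2021)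
  115–133, doi:10.4171/ecr/18-1/7, arXiv:2011.00309: Thm. 1.2.
* [LSSY2005] E. H. Lieb, R. Seiringer, J. P. Solovej, J. Yngvason, *The Mathematics of the Bose Gas
  and its Condensation*, Oberwolfach Seminars 34, Birkhäuser 2005: Thm. 2.2 (2.14), App. C Thm. C.1.
-/

noncomputable section

open MeasureTheory Filter
open scoped ENNReal NNReal

namespace Summit.AtomisticToContinuum.BoseEinsteinCondensation.Theorems

open Literature.MathematicalPhysics.QuantumManyBody.BoseGas

section GPScaleCondensation

/-- Cube root of a cube: `(x³)^{1/3} = x` for `x ≥ 0`. [folklore] -/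
theorem gpScale_rpow_third_pow_three {x : ℝ} (hx : 0 ≤ x) : (x ^ 3) ^ ((1:ℝ) / 3) = x := by
  have h := Real.pow_rpow_inv_natCast hx (show (3:ℕ) ≠ 0 by norm_num)
  simpa [one_div] using h

/-- Cube-root monotonicity in the form used twice below: `a·x^{1/3} ≤ y^{1/3}` whenever
`a³x ≤ y` (`a, x ≥ 0`). [folklore] -/
theorem gpScale_mul_rpow_third_le {a x y : ℝ} (ha : 0 ≤ a) (hx : 0 ≤ x) (hxy : a ^ 3 * x ≤ y) :
    a * x ^ ((1:ℝ) / 3) ≤ y ^ ((1:ℝ) / 3) := by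
  calc a * x ^ ((1:ℝ) / 3) = (a ^ 3) ^ ((1:ℝ) / 3) * x ^ ((1:ℝ) / 3) := by
        rw [gpScale_rpow_third_pow_three ha]
    _ = (a ^ 3 * x) ^ ((1:ℝ) / 3) := by rw [Real.mul_rpow (by positivity) hx]
    _ ≤ y ^ ((1:ℝ) / 3) := Real.rpow_le_rpow (by positivity) hxy (by norm_num)

/-- **Complete BEC of periodic near-ground states on GP⁺ boxes** (given [Fournais2020, Thm. 1.2]
as the named fact `hFou : Fournais2020_condensation`, which the tree proves).  For a measurable
repulsive potential `v` of finite range `R₀`, integrable (`∫ v(|x|)dx < ∞`) and with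
positive scattering length `a`, and for every `C_L > 0`, `δ > 0`: there are `C, c > 0` such that for
all `N ≥ 2` and `L > 2R₀` with `ρa³ ≤ c` (`ρ = N/L³`) and `L = C_L(ρa³)^{-δ}(ρa)^{-1/2}`, every
periodic trial state `Ψ` with `⟨Ψ,HΨ⟩ ≤ E₀^per(N,L) + aρ(ρa³)^{1/3}N` obeys
`N ≤ ⟨Ψ,n₀Ψ⟩ + C ρ a L² (ρa³)^{1/3} N`.  Proof: the Dyson–LSSY upper bound gives
`⟨Ψ,HΨ⟩ ≤ 4πρ₁a(1 + C_u a/b)N + aρ(ρa³)^{1/3}N ≤ 4πaρN + C₀ aρ(ρa³)^{1/2-1/6}N` with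
`a/b = a(4πρ₁/3)^{1/3} ≤ (4π/3)^{1/3}(ρa³)^{1/3}`, `ρ₁ ≤ ρ`, `C₀ = 4πC_u(4π/3)^{1/3} + 1`, and
[Fournais2020, Thm. 1.2] with `ε = 1/6` concludes.
[cite: Fournais2020, Thm. 1.2; LSSY2005, Thm. 2.2 (2.14)] -/
theorem periodicNearGroundState_condensation_gpScale (hFou : Fournais2020_condensation)
    (v : ℝ → ℝ≥0∞) (hmeas : Measurable v) (R₀ : ℝ) (hR₀ : ∀ r, R₀ < r → v r = 0)
    (hint : (∫⁻ x : Space, v ‖x‖) ≠ ⊤) (hapos : 0 < scatteringLength v)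
    (C_L δ : ℝ) (hC_L : 0 < C_L) (hδ : 0 < δ) :
    ∃ C c : ℝ, 0 < C ∧ 0 < c ∧
      ∀ (N : ℕ) (L : ℝ), 2 ≤ N → 0 < L → 2 * R₀ < L →
        let a := (scatteringLength v).toReal
        let ρ := (N : ℝ) / L ^ 3
        ρ * a ^ 3 ≤ c →
        L = C_L * (ρ * a ^ 3) ^ (-δ) / Real.sqrt (ρ * a) →
        ∀ Ψ : PeriodicTrialState N L,
          periodicEnergy v Ψ ≤ periodicGroundStateEnergy v N L +
              ENNReal.ofReal (a * ρ * (ρ * a ^ 3) ^ ((1:ℝ) / 3) * N) →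
          (N : ℝ≥0∞) ≤ condensateOccupation N L Ψ.ψ +
              ENNReal.ofReal (C * ρ * a * L ^ 2 * (ρ * a ^ 3) ^ ((1:ℝ) / 3) * N) := by
  have hπ : 0 < Real.pi := Real.pi_pos
  -- finite range ⇒ finite scattering length (`a ≤ max R₀ 0`)
  have haTop : scatteringLength v ≠ ⊤ := by
    have h := scatteringLength_le_range (v := v) (le_max_right R₀ 0)
      (fun r hr => hR₀ r (lt_of_le_of_lt (le_max_left R₀ 0) hr))
    exact ne_top_of_le_ne_top ENNReal.ofReal_ne_top h
  -- the two proved literature theorems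
  obtain ⟨C_u, c_u, hC_u, hc_u, H_u⟩ := LSSY2005_upperBound_periodic_holds v R₀ hmeas hR₀ haTop
  set κ : ℝ := (4 * Real.pi / 3) ^ ((1:ℝ) / 3) with hκ
  have hκ0 : 0 ≤ κ := by positivity
  set C₀ : ℝ := 4 * Real.pi * C_u * κ + 1 with hC₀
  have hC₀pos : 0 < C₀ := by positivity
  obtain ⟨C_F, c_F, hC_F, hc_F, H_F⟩ := hFou v ⟨hmeas, R₀, hR₀⟩ hint
    hapos C_L δ (1 / 6) C₀ hC_L hδ (by norm_num) (by norm_num) hC₀pos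
  -- smallness threshold: Fournais's, and `(4π/3)ρa³ ≤ c_u³` for the upper bound's `a/b ≤ c_u`
  set c' : ℝ := 3 / (4 * Real.pi) * c_u ^ 3 with hc'
  have hc'pos : 0 < c' := by positivity
  refine ⟨C_F, min c_F c', hC_F, lt_min hc_F hc'pos, ?_⟩
  intro N L hN2 hL hRL a ρ hsmall hLeq Ψ hE
  -- positivity bookkeeping
  have hN1 : (1 : ℝ) ≤ N := by exact_mod_cast (le_trans (by norm_num) hN2 : 1 ≤ N)
  have hNpos : 0 < N := lt_of_lt_of_le (by norm_num) hN2
  have hN0 : (0 : ℝ) ≤ N := by positivity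
  have hL3 : 0 < L ^ 3 := by positivity
  have ha0 : 0 ≤ a := ENNReal.toReal_nonneg
  have hρ0 : 0 ≤ ρ := by
    show 0 ≤ (N : ℝ) / L ^ 3
    positivity
  set ρ₁ : ℝ := ((N : ℝ) - 1) / L ^ 3 with hρ₁
  have hρ₁0 : 0 ≤ ρ₁ := div_nonneg (by linarith) hL3.le
  have hρ₁ρ : ρ₁ ≤ ρ := by
    show ((N : ℝ) - 1) / L ^ 3 ≤ (N : ℝ) / L ^ 3
    exact div_le_div_of_nonneg_right (by linarith) hL3.le
  set s : ℝ := (ρ * a ^ 3) ^ ((1:ℝ) / 3) with hs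
  have hs0 : 0 ≤ s := by positivity
  have hsmallF : ρ * a ^ 3 ≤ c_F := le_trans hsmall (min_le_left _ _)
  have hsmall' : ρ * a ^ 3 ≤ c' := le_trans hsmall (min_le_right _ _)
  -- the ratio `a/b` of the upper bound: `a/b = a(4πρ₁/3)^{1/3} ≤ κ s` and `≤ c_u`
  have hx0 : 0 ≤ 4 * Real.pi * ρ₁ / 3 := by positivity
  set t : ℝ := a * (4 * Real.pi * ρ₁ / 3) ^ ((1:ℝ) / 3) with ht
  have ht0 : 0 ≤ t := by positivity
  have hab_eq : a / (4 * Real.pi * ρ₁ / 3) ^ (-(1:ℝ) / 3) = t := by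
    rw [ht, neg_div, Real.rpow_neg hx0, div_inv_eq_mul]
  have ha3 : 0 ≤ a ^ 3 := by positivity
  have hcube : a ^ 3 * (4 * Real.pi * ρ₁ / 3) = (4 * Real.pi / 3) * (ρ₁ * a ^ 3) := by ring
  have hρa : ρ₁ * a ^ 3 ≤ ρ * a ^ 3 := mul_le_mul_of_nonneg_right hρ₁ρ ha3
  have ht_le : t ≤ κ * s := by
    have h1 : t ≤ ((4 * Real.pi / 3) * (ρ * a ^ 3)) ^ ((1:ℝ) / 3) := by
      apply gpScale_mul_rpow_third_le ha0 hx0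
      rw [hcube]
      exact mul_le_mul_of_nonneg_left hρa (by positivity)
    rw [hκ, hs, ← Real.mul_rpow (by positivity) (by positivity)]
    exact h1
  have ht_cu : t ≤ c_u := by
    have h1 : t ≤ (c_u ^ 3) ^ ((1:ℝ) / 3) := by
      apply gpScale_mul_rpow_third_le ha0 hx0
      rw [hcube]
      calc (4 * Real.pi / 3) * (ρ₁ * a ^ 3) ≤ (4 * Real.pi / 3) * c' :=
            mul_le_mul_of_nonneg_left (le_trans hρa hsmall') (by positivity)
        _ = c_u ^ 3 := by
            rw [hc']
            field_simp
    rwa [gpScale_rpow_third_pow_three hc_u.le] at h1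
  -- Dyson–LSSY upper bound on `E₀^per(N, L)`
  have hU : periodicGroundStateEnergy v N L ≤ ENNReal.ofReal
      (4 * Real.pi * ρ₁ * a * (1 + C_u * (a / (4 * Real.pi * ρ₁ / 3) ^ (-(1:ℝ) / 3))) * N) :=
    H_u N L hN2 hL hRL (by rw [hab_eq]; exact ht_cu)
  rw [hab_eq] at hU
  -- the energy hypothesis of [Fournais2020, Thm. 1.2] with `ε = 1/6`
  have hexp : (1 / 2 - 1 / 6 : ℝ) = 1 / 3 := by norm_num
  have hU0 : 0 ≤ 4 * Real.pi * ρ₁ * a * (1 + C_u * t) * N := by positivity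
  have hsl0 : 0 ≤ a * ρ * s * N := by positivity
  have hreal : 4 * Real.pi * ρ₁ * a * (1 + C_u * t) * N + a * ρ * s * N
      ≤ 4 * Real.pi * a * ρ * N + C₀ * a * ρ * (ρ * a ^ 3) ^ (1 / 2 - 1 / 6 : ℝ) * N := by
    rw [hexp, ← hs, hC₀]
    have hA : ρ₁ * t ≤ ρ * (κ * s) := mul_le_mul hρ₁ρ ht_le ht0 hρ0
    have hB : 0 ≤ 4 * Real.pi * a * N := by positivity
    have hC : 0 ≤ 4 * Real.pi * a * C_u * N := by positivity
    have key : 4 * Real.pi * a * ρ * N + (4 * Real.pi * C_u * κ + 1) * a * ρ * s * N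
        - (4 * Real.pi * ρ₁ * a * (1 + C_u * t) * N + a * ρ * s * N)
        = 4 * Real.pi * a * N * (ρ - ρ₁) + 4 * Real.pi * a * C_u * N * (ρ * (κ * s) - ρ₁ * t) := by
      ring
    have h1 : 0 ≤ 4 * Real.pi * a * N * (ρ - ρ₁) := mul_nonneg hB (sub_nonneg.2 hρ₁ρ)
    have h2 : 0 ≤ 4 * Real.pi * a * C_u * N * (ρ * (κ * s) - ρ₁ * t) :=
      mul_nonneg hC (sub_nonneg.2 hA)
    linarith
  have hE' : periodicEnergy v Ψ ≤ ENNReal.ofReal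
      (4 * Real.pi * a * ρ * N + C₀ * a * ρ * (ρ * a ^ 3) ^ (1 / 2 - 1 / 6 : ℝ) * N) :=
    calc periodicEnergy v Ψ
        ≤ periodicGroundStateEnergy v N L + ENNReal.ofReal (a * ρ * s * N) := hE
      _ ≤ ENNReal.ofReal (4 * Real.pi * ρ₁ * a * (1 + C_u * t) * N)
            + ENNReal.ofReal (a * ρ * s * N) := add_le_add hU le_rfl
      _ = ENNReal.ofReal (4 * Real.pi * ρ₁ * a * (1 + C_u * t) * N + a * ρ * s * N) :=
            (ENNReal.ofReal_add hU0 hsl0).symm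
      _ ≤ _ := ENNReal.ofReal_le_ofReal hreal
  -- [Fournais2020, Thm. 1.2]
  have hF := H_F N L hNpos hL hsmallF hLeq Ψ hE'
  rw [hexp] at hF
  exact hF

/-- The box–density pinning in numbers: `L = C_L(ρa³)^{-δ}(ρa)^{-1/2}` gives
`ρ a L² = C_L² (ρa³)^{-2δ}` (`ρa > 0`, `ρa³ > 0`). [folklore] -/
theorem gpScale_rho_a_L_sq {ρ a C_L δ L : ℝ} (hρa : 0 < ρ * a) (hx : 0 < ρ * a ^ 3)
    (hL : L = C_L * (ρ * a ^ 3) ^ (-δ) / Real.sqrt (ρ * a)) :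
    ρ * a * L ^ 2 = C_L ^ 2 * (ρ * a ^ 3) ^ (-2 * δ) := by
  have hsq : Real.sqrt (ρ * a) ^ 2 = ρ * a := Real.sq_sqrt hρa.le
  have hpow : ((ρ * a ^ 3) ^ (-δ)) ^ 2 = (ρ * a ^ 3) ^ (-2 * δ) := by
    rw [← Real.rpow_natCast ((ρ * a ^ 3) ^ (-δ)) 2, ← Real.rpow_mul hx.le]
    congr 1
    push_cast
    ring
  have hne : ρ * a ≠ 0 := hρa.ne'
  rw [hL, div_pow, mul_pow, hsq, hpow, ← mul_div_assoc, mul_comm (ρ * a) (C_L ^ 2 * _),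
    mul_div_assoc, div_self hne, mul_one]

/-- **Complete BEC of periodic near-ground states on GP⁺ boxes — the rate.**  Same hypotheses as
`periodicNearGroundState_condensation_gpScale`; the depletion bound rewritten with
`ρaL² = C_L²(ρa³)^{-2δ}`: `N ≤ ⟨Ψ,n₀Ψ⟩ + C C_L² (ρa³)^{1/3-2δ} N` — complete condensation as
`ρa³ → 0` exactly when `δ < 1/6` (boxes up to `(ρa³)^{-1/6}` healing lengths at this energy
precision; [Fournais2020, Thm. 1.2] allows `2δ + ε < 1/2` given an energy bound of precision
`(ρa³)^{1/2-ε}`, and the tree's proved upper bound supplies `ε = 1/6`).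
[cite: Fournais2020, Thm. 1.2 and the sentence after (1.9); LSSY2005, Thm. 2.2 (2.14)] -/
theorem periodicNearGroundState_condensation_gpScale_rate (hFou : Fournais2020_condensation)
    (v : ℝ → ℝ≥0∞) (hmeas : Measurable v) (R₀ : ℝ) (hR₀ : ∀ r, R₀ < r → v r = 0)
    (hint : (∫⁻ x : Space, v ‖x‖) ≠ ⊤) (hapos : 0 < scatteringLength v)
    (C_L δ : ℝ) (hC_L : 0 < C_L) (hδ : 0 < δ) :
    ∃ C c : ℝ, 0 < C ∧ 0 < c ∧
      ∀ (N : ℕ) (L : ℝ), 2 ≤ N → 0 < L → 2 * R₀ < L →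
        let a := (scatteringLength v).toReal
        let ρ := (N : ℝ) / L ^ 3
        ρ * a ^ 3 ≤ c →
        L = C_L * (ρ * a ^ 3) ^ (-δ) / Real.sqrt (ρ * a) →
        ∀ Ψ : PeriodicTrialState N L,
          periodicEnergy v Ψ ≤ periodicGroundStateEnergy v N L +
              ENNReal.ofReal (a * ρ * (ρ * a ^ 3) ^ ((1:ℝ) / 3) * N) →
          (N : ℝ≥0∞) ≤ condensateOccupation N L Ψ.ψ +
              ENNReal.ofReal (C * C_L ^ 2 * (ρ * a ^ 3) ^ ((1:ℝ) / 3 - 2 * δ) * N) := by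
  have haTop : scatteringLength v ≠ ⊤ := by
    have h := scatteringLength_le_range (v := v) (le_max_right R₀ 0)
      (fun r hr => hR₀ r (lt_of_le_of_lt (le_max_left R₀ 0) hr))
    exact ne_top_of_le_ne_top ENNReal.ofReal_ne_top h
  obtain ⟨C, c, hC, hc, H⟩ :=
    periodicNearGroundState_condensation_gpScale hFou v hmeas R₀ hR₀ hint hapos C_L δ hC_L hδ
  refine ⟨C, c, hC, hc, ?_⟩
  intro N L hN2 hL hRL a ρ hsmall hLeq Ψ hE
  have h := H N L hN2 hL hRL hsmall hLeq Ψ hE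
  have hNpos : (0 : ℝ) < N := by exact_mod_cast lt_of_lt_of_le (by norm_num) hN2
  have ha : 0 < a := ENNReal.toReal_pos hapos.ne' haTop
  have hρ : 0 < ρ := by
    show 0 < (N : ℝ) / L ^ 3
    positivity
  have hx : 0 < ρ * a ^ 3 := by positivity
  have hρa : 0 < ρ * a := by positivity
  have key : C * ρ * a * L ^ 2 * (ρ * a ^ 3) ^ ((1:ℝ) / 3) * N
      = C * C_L ^ 2 * (ρ * a ^ 3) ^ ((1:ℝ) / 3 - 2 * δ) * N := by
    have h1 := gpScale_rho_a_L_sq (C_L := C_L) (δ := δ) hρa hx hLeq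
    have h2 : (ρ * a ^ 3) ^ ((1:ℝ) / 3 - 2 * δ)
        = (ρ * a ^ 3) ^ (-2 * δ) * (ρ * a ^ 3) ^ ((1:ℝ) / 3) := by
      rw [← Real.rpow_add hx]
      congr 1
      ring
    calc C * ρ * a * L ^ 2 * (ρ * a ^ 3) ^ ((1:ℝ) / 3) * N
        = C * (ρ * a * L ^ 2) * (ρ * a ^ 3) ^ ((1:ℝ) / 3) * N := by ring
      _ = C * (C_L ^ 2 * (ρ * a ^ 3) ^ (-2 * δ)) * (ρ * a ^ 3) ^ ((1:ℝ) / 3) * N := by rw [h1]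
      _ = C * C_L ^ 2 * (ρ * a ^ 3) ^ ((1:ℝ) / 3 - 2 * δ) * N := by rw [h2]; ring
  calc (N : ℝ≥0∞) ≤ condensateOccupation N L Ψ.ψ +
        ENNReal.ofReal (C * ρ * a * L ^ 2 * (ρ * a ^ 3) ^ ((1:ℝ) / 3) * N) := h
    _ = _ := by rw [key]

end GPScaleCondensation

end Summit.AtomisticToContinuum.BoseEinsteinCondensation.Theorems

end
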